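import Summits.QuantumFields.YangMills.Theorems.BalabanUVNodesN18LocalGaugeTransportStep
import Summits.QuantumFields.YangMills.Theorems.BalabanUVNodesN18TwoRunCubeDictionary
import Summits.QuantumFields.BalabanUV.T4Continuum.Support.B13Carriers

/-!
# BalabanUVNodes ∕ node N18 = NE5 — closure-ledger item (iii), (β) AT THE CHART LEVEL READ ON THE TWO RUNS: the one-step (1.12) transport of file 5 AT THE TRANSPORT OF
# RECORD `transportRaw F k (blockAvg expMeanLogSU)` (run B's (0.4) average + the ladder `T_B^{(1)} = T_A^{(0)}`), WITH HYPOTHESES ON THE BONDS OF RUN B's REGION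
# `regionOfSet (bmap ⁻¹' Z)` OVER A RUN-A SITE SET `Z` (dag-n18-d 19c's dictionary) — the letters of `Sect2.CondI.localGauge` one run up, bond by bond and stencil by stencil
# (Track A, DAG node N18 = `T4OutputRate.NE5` :211; cluster K4 «SpineRates», item K3⁷ `SpineGivenEndpointR13SepCoPH`; WIDTH SEAT pub-ymgap-dag-n18-w3 g2, file 6)

HONEST FRAMING.  Count-neutral kernel bookkeeping (`--supports stmt-QuantumFields-20544 --as helper`); elementary, PROVED: file 5's transported clause at `P := F.P (k+1)`,
`j := 0` (standing range `YMDAG.N18.TwoRunCubes.standing`), the two-block read sets and feeding sites mapped into run B's region over `Z` by the block map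
`bmap x = (siteShift ladder)⁻¹ (blockOf x)` (as in 19c `runBond_blockSite_mem_bonds_preimage` ∕ `feedSite_mem_dpairs_preimage`), and `transportRaw_apply` ∕ `blockAvg_avg`
(the transport of record at `⟨y, μ⟩` IS `Ū(⟨siteShift y, μ⟩)`).  NE5 is NOT PRINTED and NOT proved; N18 is NOT discharged; `hT₀`∕`hTsp` NOT discharged here.

WHY.  dag-n18-d's closure ledger (iii) reads the (1.12) clause at the TABLE OF RECORD on run A's cube-regions `Sect2.cubesI M j (domSites Y)`, i.e. on
`regionOfSet (□_A ∩ Y_A)`; 19c showed that the block-preimage region is run B's cube-region of the same index at the paired domain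
(`regionOfSet_preimage_mem_cubesI_succ`), so run B's (1.12) clause there is exactly the INPUT of this file's theorems with `Z := □_A ∩ Y_A`.  What is left for the
`CondI.localGauge` field of `Sect2.frameI` on run A is then the re-lettering `gaugeU ∕ expI ∕ grad` of `B12RegularSpaces111` (units of `M_N(ℂ)` vs `SU(N)`-valued fields,
`grad ξ ν f x = ξ⁻¹(f(x + e_ν) − f x)`) and the radii step law (γ′) — not analysis.

WHAT (`F : T4Family`, `k : ℕ`, `N`; `U : GaugeField (F.P (k+1)) 0 SU(N)`, `u` the run-B cube's gauge, `A` bondwise Hermitian traceless; `Z : Set (Site (F.P k) 0)`;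
`bmap x := (siteShift (ladder F k)).symm (blockOf x)`; `0 ≤ ξ`, `48ℓξr ≤ 1`, `4ℓξr < δ_N`, `ℓ = (d+2)L = 6L`).
* §1 dictionary: `twoBlocks_subset_bonds_preimage` (a fine bond with both block-ends over `{y, y + e_μ} ⊂ Z` is a bond of `regionOfSet (bmap ⁻¹' Z)`),
  `twoBlocks_pair_subset_bonds_preimage` (the same for the blocks of `⟨y, μ⟩` and `⟨y + e_ν, μ⟩` at a stencil `(y, ν, μ)` of `regionOfSet Z`),
  `translate_L_mem_bonds_preimage` (the `Le_ν`-translates of the two-block bonds of `⟨y, μ⟩` are bonds of the preimage region at a stencil),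
  `gaugeAct_transportRaw_eq` (the transport of record of `U`, gauge-transformed by the coarse gauge read on run A, at `⟨y, μ⟩` = file 5's `Ū^{u′}(⟨siteShift y, μ⟩)`);
  §2 `translate_step_mem_dpairs_preimage` (the unit steps of the `Le_ν`-telescoping stay in the region's stencils).
* §2 ★ `coe_transportRaw_gaugeAct_eq_exp_mlog` (`(T U)^{u′_A}(b) = exp(log (T U)^{u′_A}(b))` for `b ∈ (regionOfSet Z).bonds`), ★ `norm_mlog_transportRaw_gaugeAct_le`
  (SUP letter `≤ Lξ·r + 2000ℓ²ξ²r²` from `‖A‖ ≤ r` on the bonds of `regionOfSet (bmap ⁻¹' Z)`), ★ `norm_shift_sub_mlog_transportRaw_gaugeAct_le` (COARSE-DIFFERENCE letter at a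
  stencil `(y, ν, μ)` of `regionOfSet Z`: `≤ Lξ·L·r₁ + 3200ℓ²ξ²r·(L·r₁)` from `‖A‖ ≤ r` and the unit `ν`-differences `≤ r₁` on the bonds of `regionOfSet (bmap ⁻¹' Z)`).

WHAT THIS IS NOT.  Not the `CondI` structure itself (units `M_N(ℂ)ˣ`, `gaugeU`, `expI`, `grad` re-lettering; (1.11) part = dag-n18-d m13 ∕ n18-e m11); not (γ′); not
(T1)∕(T2)∕orbit-(T3); not the complexified twins; finite tori at fixed `ε` — not continuum ∕ OS ∕ mass gap ∕ Clay.  0 `def`, 0 `sorry`, standard axioms.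
-/

open scoped BigOperators

namespace YMDAG.N18.AvgPotential

open NormedSpace (exp)
open Literature.MathematicalPhysics.QuantumFieldTheory.Balaban1983to89
open Literature.MathematicalPhysics.QuantumFieldTheory.Balaban1983to89.T4Continuum
open Literature.MathematicalPhysics.QuantumFieldTheory.Balaban1983to89.T4LevelShift
open Literature.MathematicalPhysics.QuantumFieldTheory.Balaban1983to89.BlockAveraging
open Literature.MathematicalPhysics.QuantumFieldTheory.Balaban1983to89.LatticeFieldCalculus (bondAvg runBond runSite)
open Literature.MathematicalPhysics.QuantumFieldTheory.Balaban1983to89.ExpMeanLog (deltaSU expMeanLogSU)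
open Literature.MathematicalPhysics.QuantumFieldTheory.Balaban1983to89.MatrixLog (mlog)
open Literature.MathematicalPhysics.QuantumFieldTheory.Balaban1983to89.BlockAveragingEMLLinearised (combMean)
open Literature.MathematicalPhysics.QuantumFieldTheory.Balaban1983to89.Node00.Sect2 (regionOfSet)
open Summit.QuantumFields.BalabanUV.T4Continuum.B13Carriers (transportRaw transportRaw_apply)
open YMDAG.N18.TwoRunCubes (ladder standing)

open scoped Matrix.Norms.L2Operator

variable {N : ℕ} [NeZero N] (F : T4Family) (k : ℕ)

/-! ## §1 Dictionary: two-block read sets and their `Le_ν`-translates are bonds of run B's region over `Z` -/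

section Dictionary

/-- **A fine bond whose ends have their blocks over `{y, y + e_μ} ⊂ Z` is a bond of run B's region over `Z`** (`regionOfSet (bmap ⁻¹' Z)`, 19c's `bmap`).
[cite: Balaban1987RG1, (1.12) p.262, (0.24)-(0.25) p.257] -/
theorem twoBlocks_subset_bonds_preimage (Z : Set (Site (F.P k) 0)) {y : Site (F.P k) 0} {μ : Fin 4}
    (hb : (⟨y, μ⟩ : PBond (F.P k) 0) ∈ (regionOfSet (F.P k) Z).bonds) (b : PBond (F.P (k + 1)) 0)
    (h1 : blockOf b.src = siteShift (ladder F k) y ∨ blockOf b.src = (siteShift (ladder F k) y).shift μ)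
    (h2 : blockOf b.tgt = siteShift (ladder F k) y ∨ blockOf b.tgt = (siteShift (ladder F k) y).shift μ) :
    b ∈ (regionOfSet (F.P (k + 1)) ((fun x => (siteShift (ladder F k)).symm (blockOf x)) ⁻¹' Z)).bonds := by
  obtain ⟨hy, hyμ⟩ := hb
  have hyμ' : y.shift μ ∈ Z := hyμ
  refine ⟨?_, ?_⟩
  · show (siteShift (ladder F k)).symm (blockOf b.src) ∈ Z
    rcases h1 with h | h
    · rw [h, Equiv.symm_apply_apply]; exact hy
    · rw [h, ← siteShift_shift, Equiv.symm_apply_apply]; exact hyμ'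
  · show (siteShift (ladder F k)).symm (blockOf b.tgt) ∈ Z
    rcases h2 with h | h
    · rw [h, Equiv.symm_apply_apply]; exact hy
    · rw [h, ← siteShift_shift, Equiv.symm_apply_apply]; exact hyμ'

/-- At a stencil `(y, ν, μ)` of `regionOfSet Z` (corners `y, y+e_ν, y+e_μ, y+e_ν+e_μ ∈ Z`) the two-block read sets of BOTH `⟨y, μ⟩` and `⟨y + e_ν, μ⟩` are bonds of run B's
region over `Z`. [cite: Balaban1987RG1, (1.12) p.262, (0.24)-(0.25) p.257] -/
theorem twoBlocks_pair_subset_bonds_preimage (Z : Set (Site (F.P k) 0)) {y : Site (F.P k) 0} {ν μ : Fin 4}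
    (hq : (y, ν, μ) ∈ (regionOfSet (F.P k) Z).dpairs) (b : PBond (F.P (k + 1)) 0)
    (h : ((blockOf b.src = siteShift (ladder F k) y ∨ blockOf b.src = (siteShift (ladder F k) y).shift μ) ∧
          (blockOf b.tgt = siteShift (ladder F k) y ∨ blockOf b.tgt = (siteShift (ladder F k) y).shift μ)) ∨
        ((blockOf b.src = (siteShift (ladder F k) y).shift ν ∨ blockOf b.src = ((siteShift (ladder F k) y).shift ν).shift μ) ∧
          (blockOf b.tgt = (siteShift (ladder F k) y).shift ν ∨ blockOf b.tgt = ((siteShift (ladder F k) y).shift ν).shift μ))) :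
    b ∈ (regionOfSet (F.P (k + 1)) ((fun x => (siteShift (ladder F k)).symm (blockOf x)) ⁻¹' Z)).bonds := by
  obtain ⟨h0, hν, hμ, hνμ⟩ := hq
  rcases h with ⟨h1, h2⟩ | ⟨h1, h2⟩
  · exact twoBlocks_subset_bonds_preimage F k Z ⟨h0, hμ⟩ b h1 h2
  · have hb' : (⟨y.shift ν, μ⟩ : PBond (F.P k) 0) ∈ (regionOfSet (F.P k) Z).bonds := ⟨hν, hνμ⟩
    rw [← siteShift_shift] at h1 h2
    exact twoBlocks_subset_bonds_preimage F k Z hb' b h1 h2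

/-- The `Le_ν`-translate of a fine bond with both block-ends over `{y, y + e_μ}` has both block-ends over `{y + e_ν, y + e_ν + e_μ}` — so at a stencil `(y, ν, μ)` of
`regionOfSet Z` it is a bond of run B's region over `Z` (file 4 `blockOf_translate_L_shift`). [cite: Balaban1987RG1, (2.17) p.269, (1.12) p.262] -/
theorem translate_L_mem_bonds_preimage (Z : Set (Site (F.P k) 0)) {y : Site (F.P k) 0} {ν μ : Fin 4}
    (hq : (y, ν, μ) ∈ (regionOfSet (F.P k) Z).dpairs) (b : PBond (F.P (k + 1)) 0)
    (h1 : blockOf b.src = siteShift (ladder F k) y ∨ blockOf b.src = (siteShift (ladder F k) y).shift μ)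
    (h2 : blockOf b.tgt = siteShift (ladder F k) y ∨ blockOf b.tgt = (siteShift (ladder F k) y).shift μ) :
    b.translate ((F.P (k + 1)).L • (0 : Site (F.P (k + 1)) 0).shift ν) ∈
      (regionOfSet (F.P (k + 1)) ((fun x => (siteShift (ladder F k)).symm (blockOf x)) ⁻¹' Z)).bonds := by
  obtain ⟨h0, hν, hμ, hνμ⟩ := hq
  have hbl := blockOf_translate_L_shift (standing F k) b ν
  have hb' : (⟨y.shift ν, μ⟩ : PBond (F.P k) 0) ∈ (regionOfSet (F.P k) Z).bonds := ⟨hν, hνμ⟩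
  refine twoBlocks_subset_bonds_preimage F k Z hb' _ ?_ ?_
  · rw [hbl.1, siteShift_shift]
    rcases h1 with h | h <;> rw [h]
    · exact Or.inl rfl
    · exact Or.inr (Site.shift_comm _ _ _)
  · rw [hbl.2, siteShift_shift]
    rcases h2 with h | h <;> rw [h]
    · exact Or.inl rfl
    · exact Or.inr (Site.shift_comm _ _ _)

/-- **THE TRANSPORT OF RECORD, GAUGE-TRANSFORMED ON RUN A, IS FILE 5's COARSE-GAUGE FIELD READ THROUGH THE LADDER**: for the run-A gauge `u′_A x := u′(siteShift x)`,
`((T U)^{u′_A})(⟨y, μ⟩) = (Ū^{u′})(⟨siteShift y, μ⟩)` with `T = transportRaw F k (blockAvg ℰp)` (`transportRaw_apply`, `blockAvg_avg`, `siteShift_shift`).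
[cite: Balaban1987RG1, (0.8)-(0.11) p.253, (0.24)-(0.25) p.257] -/
theorem gaugeAct_transportRaw_eq (U : GaugeField (F.P (k + 1)) 0 (Matrix.specialUnitaryGroup (Fin N) ℂ))
    (u' : GaugeTransf (F.P (k + 1)) 1 (Matrix.specialUnitaryGroup (Fin N) ℂ)) (y : Site (F.P k) 0) (μ : Fin 4) :
    GaugeField.gaugeAct (fun x => u' (siteShift (ladder F k) x)) (transportRaw F k (blockAvg (expMeanLogSU (n := Fin N))) U) ⟨y, μ⟩ =
      GaugeField.gaugeAct u' (avgFun (expMeanLogSU (n := Fin N)) U) ⟨siteShift (ladder F k) y, μ⟩ := by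
  simp only [GaugeField.gaugeAct, transportRaw_apply, blockAvg_avg, PBond.tgt, siteShift_shift]
  rfl

end Dictionary

/-! ## §2 The transported (1.12) clause at the transport of record, read on run A's region `regionOfSet Z` -/

section Cube

open Literature.MathematicalPhysics.QuantumFieldTheory.Balaban1983to89.B5AveragingLocalityV1 (runBond_blockSite_local)
open YMDAG.N18.TwoRunCubes (blockOf_runSite_or)

omit [NeZero N] in
/-- `x + m·e_ν` as the straight run site (`runSite`). [folklore] -/
private theorem add_nsmul_zero_shift_eq_runSite {P : Params} {i : ℕ} (x : Site P i) (ν : Fin P.d) :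
    ∀ m : ℕ, x + m • (0 : Site P i).shift ν = runSite x ν m
  | 0 => by rw [zero_nsmul, add_zero, LatticeFieldCalculus.runSite_zero]
  | m + 1 => by rw [succ_nsmul, ← add_assoc, add_nsmul_zero_shift_eq_runSite x ν m, Site.add_zero_shift, LatticeFieldCalculus.runSite_succ]

/-- **The unit steps of the `Le_ν`-telescoping stay in run B's region over `Z`** at a stencil: for a fine bond `b` with both block-ends over `{y, y + e_μ}` and `m < L`, the
stencil `((b + m·e_ν).src, ν, b.dir)` of the fine lattice is a stencil of `regionOfSet (bmap ⁻¹' Z)` whenever `(y, ν, μ)` is a stencil of `regionOfSet Z` (straight runs of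
`≤ L` steps move blocks by at most one coarse step, 19c `blockOf_runSite_or`). [cite: Balaban1984PropagatorsI, (1.8) p.19; Balaban1987RG1, (1.12) p.262] -/
theorem translate_step_mem_dpairs_preimage (Z : Set (Site (F.P k) 0)) {y : Site (F.P k) 0} {ν μ : Fin 4}
    (hq : (y, ν, μ) ∈ (regionOfSet (F.P k) Z).dpairs) (b : PBond (F.P (k + 1)) 0)
    (h1 : blockOf b.src = siteShift (ladder F k) y ∨ blockOf b.src = (siteShift (ladder F k) y).shift μ)
    (h2 : blockOf b.tgt = siteShift (ladder F k) y ∨ blockOf b.tgt = (siteShift (ladder F k) y).shift μ) {m : ℕ} (hm : m < (F.P (k + 1)).L) :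
    ((b.translate (m • (0 : Site (F.P (k + 1)) 0).shift ν)).src, ν, (b.translate (m • (0 : Site (F.P (k + 1)) 0).shift ν)).dir) ∈
      (regionOfSet (F.P (k + 1)) ((fun x => (siteShift (ladder F k)).symm (blockOf x)) ⁻¹' Z)).dpairs := by
  obtain ⟨h0, hν, hμ, hνμ⟩ := hq
  have h0' : y ∈ Z := h0
  have hν' : y.shift ν ∈ Z := hν
  have hμ' : y.shift μ ∈ Z := hμ
  have hνμ' : (y.shift ν).shift μ ∈ Z := hνμ
  set yB := siteShift (ladder F k) y with hyB
  -- a site whose block is over `{y, y+e_μ}`, run by `s ≤ L` steps in direction `ν`, has its block over one of the four corners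
  have corner : ∀ (x : Site (F.P (k + 1)) 0), (blockOf x = yB ∨ blockOf x = yB.shift μ) → ∀ {s : ℕ}, s ≤ (F.P (k + 1)).L →
      (siteShift (ladder F k)).symm (blockOf (runSite x ν s)) ∈ Z := by
    intro x hx s hs
    rcases blockOf_runSite_or (standing F k) x ν hs with h | h <;> rw [h] <;> rcases hx with hx | hx <;> rw [hx, hyB]
    · rw [Equiv.symm_apply_apply]; exact h0'
    · rw [← siteShift_shift, Equiv.symm_apply_apply]; exact hμ'
    · rw [← siteShift_shift, Equiv.symm_apply_apply]; exact hν'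
    · rw [← siteShift_shift, ← siteShift_shift, Equiv.symm_apply_apply, Site.shift_comm]; exact hνμ'
  have hsrc : (b.translate (m • (0 : Site (F.P (k + 1)) 0).shift ν)).src = runSite b.src ν m := by
    rw [PBond.translate_src, add_nsmul_zero_shift_eq_runSite]
  have htgt : b.tgt = b.src.shift b.dir := rfl
  simp only [PBond.translate_dir]
  rw [hsrc]
  refine ⟨corner b.src h1 hm.le, ?_, ?_, ?_⟩
  · show (siteShift (ladder F k)).symm (blockOf ((runSite b.src ν m).shift ν)) ∈ Z
    rw [← LatticeFieldCalculus.runSite_succ]; exact corner b.src h1 hm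
  · show (siteShift (ladder F k)).symm (blockOf ((runSite b.src ν m).shift b.dir)) ∈ Z
    have e : (runSite b.src ν m).shift b.dir = runSite b.tgt ν m := by
      rw [htgt, ← add_nsmul_zero_shift_eq_runSite, ← add_nsmul_zero_shift_eq_runSite, Site.shift_add]
    rw [e]; exact corner b.tgt h2 hm.le
  · show (siteShift (ladder F k)).symm (blockOf (((runSite b.src ν m).shift ν).shift b.dir)) ∈ Z
    have e : ((runSite b.src ν m).shift ν).shift b.dir = runSite b.tgt ν (m + 1) := by
      rw [← LatticeFieldCalculus.runSite_succ, ← add_nsmul_zero_shift_eq_runSite, ← add_nsmul_zero_shift_eq_runSite, Site.shift_add, htgt]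
    rw [e]; exact corner b.tgt h2 hm

variable {F k}

/-- ★ **`(TU)^{u′_A}(b) = exp(log (TU)^{u′_A}(b))` ON THE BONDS OF `regionOfSet Z`** — the transport of record of `U`, in the coarse gauge `u′(y) = g(y)⁻¹·u(emb y)` read on run A,
IS `exp(iξ′Ā)` bondwise on `Z`'s bonds, given run B's (1.12) letters `U^u = exp(iξA)`, `‖A‖ ≤ r` on the bonds of `regionOfSet (bmap ⁻¹' Z)` (`48ℓξr ≤ 1`, `4ℓξr < δ_N`).
[cite: Balaban1987RG1, (1.12) p.262, (0.8)-(0.11) p.253, (0.24)-(0.25) p.257] -/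
theorem coe_transportRaw_gaugeAct_eq_exp_mlog (U : GaugeField (F.P (k + 1)) 0 (Matrix.specialUnitaryGroup (Fin N) ℂ))
    (u : GaugeTransf (F.P (k + 1)) 0 (Matrix.specialUnitaryGroup (Fin N) ℂ)) {A : PBond (F.P (k + 1)) 0 → Matrix (Fin N) (Fin N) ℂ}
    (hAh : ∀ b, star (A b) = A b) {ξ r : ℝ} (hξ : 0 ≤ ξ) (hr : 0 ≤ r) {g : GaugeTransf (F.P (k + 1)) 1 (Matrix.specialUnitaryGroup (Fin N) ℂ)}
    (hg : ∀ y, ((g y : Matrix.specialUnitaryGroup (Fin N) ℂ) : Matrix (Fin N) (Fin N) ℂ) = exp ((Complex.I * ξ : ℂ) • combMean A y))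
    (Z : Set (Site (F.P k) 0))
    (hUA : ∀ b ∈ (regionOfSet (F.P (k + 1)) ((fun x => (siteShift (ladder F k)).symm (blockOf x)) ⁻¹' Z)).bonds,
      ((GaugeField.gaugeAct u U b : Matrix.specialUnitaryGroup (Fin N) ℂ) : Matrix (Fin N) (Fin N) ℂ) = exp ((Complex.I * ξ : ℂ) • A b))
    (hA : ∀ b ∈ (regionOfSet (F.P (k + 1)) ((fun x => (siteShift (ladder F k)).symm (blockOf x)) ⁻¹' Z)).bonds, ‖A b‖ ≤ r)
    (h48 : 48 * (((((F.P (k + 1)).d + 2) * (F.P (k + 1)).L : ℕ) : ℝ) * (ξ * r)) ≤ 1)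
    (hN : 4 * (((((F.P (k + 1)).d + 2) * (F.P (k + 1)).L : ℕ) : ℝ) * (ξ * r)) < deltaSU (Fin N))
    {y : Site (F.P k) 0} {μ : Fin 4} (hb : (⟨y, μ⟩ : PBond (F.P k) 0) ∈ (regionOfSet (F.P k) Z).bonds) :
    exp (mlog (((GaugeField.gaugeAct (fun x => (g (siteShift (ladder F k) x))⁻¹ * u (emb (siteShift (ladder F k) x)))
        (transportRaw F k (blockAvg (expMeanLogSU (n := Fin N))) U) ⟨y, μ⟩ : Matrix.specialUnitaryGroup (Fin N) ℂ) : Matrix (Fin N) (Fin N) ℂ))) =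
      ((GaugeField.gaugeAct (fun x => (g (siteShift (ladder F k) x))⁻¹ * u (emb (siteShift (ladder F k) x)))
        (transportRaw F k (blockAvg (expMeanLogSU (n := Fin N))) U) ⟨y, μ⟩ : Matrix.specialUnitaryGroup (Fin N) ℂ) : Matrix (Fin N) (Fin N) ℂ) := by
  have hT := gaugeAct_transportRaw_eq F k U (fun y' => (g y')⁻¹ * u (emb y')) y μ
  rw [hT]
  exact coe_gaugeAct_avgFun_eq_exp_mlog (standing F k) U u hAh hξ hr hg ⟨siteShift (ladder F k) y, μ⟩
    (fun b h1 h2 => hUA b (twoBlocks_subset_bonds_preimage F k Z hb b h1 h2))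
    (fun b h1 h2 => hA b (twoBlocks_subset_bonds_preimage F k Z hb b h1 h2)) h48 hN

/-- ★ **THE SUP LETTER ON THE BONDS OF `regionOfSet Z`**: under the same hypotheses, `‖log (TU)^{u′_A}(⟨y, μ⟩)‖ ≤ (Lξ)·r + 2000·ℓ²ξ²r²` — i.e. `|Ā| ≤ r·(1 + 2000(d+2)²·L·ξ·r)`
from run B's `|A| ≤ r` on the cube-region over `Z` (the feeding bonds lie in the two blocks, `runBond_blockSite_local`). [cite: Balaban1987RG1, (1.12) p.262; Balaban1985Averaging, Prop. 3 (123) p.36] -/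
theorem norm_mlog_transportRaw_gaugeAct_le (U : GaugeField (F.P (k + 1)) 0 (Matrix.specialUnitaryGroup (Fin N) ℂ))
    (u : GaugeTransf (F.P (k + 1)) 0 (Matrix.specialUnitaryGroup (Fin N) ℂ)) {A : PBond (F.P (k + 1)) 0 → Matrix (Fin N) (Fin N) ℂ}
    (hAh : ∀ b, star (A b) = A b) {ξ r : ℝ} (hξ : 0 ≤ ξ) (hr : 0 ≤ r) {g : GaugeTransf (F.P (k + 1)) 1 (Matrix.specialUnitaryGroup (Fin N) ℂ)}
    (hg : ∀ y, ((g y : Matrix.specialUnitaryGroup (Fin N) ℂ) : Matrix (Fin N) (Fin N) ℂ) = exp ((Complex.I * ξ : ℂ) • combMean A y))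
    (Z : Set (Site (F.P k) 0))
    (hUA : ∀ b ∈ (regionOfSet (F.P (k + 1)) ((fun x => (siteShift (ladder F k)).symm (blockOf x)) ⁻¹' Z)).bonds,
      ((GaugeField.gaugeAct u U b : Matrix.specialUnitaryGroup (Fin N) ℂ) : Matrix (Fin N) (Fin N) ℂ) = exp ((Complex.I * ξ : ℂ) • A b))
    (hA : ∀ b ∈ (regionOfSet (F.P (k + 1)) ((fun x => (siteShift (ladder F k)).symm (blockOf x)) ⁻¹' Z)).bonds, ‖A b‖ ≤ r)
    (h48 : 48 * (((((F.P (k + 1)).d + 2) * (F.P (k + 1)).L : ℕ) : ℝ) * (ξ * r)) ≤ 1)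
    (hN : 4 * (((((F.P (k + 1)).d + 2) * (F.P (k + 1)).L : ℕ) : ℝ) * (ξ * r)) < deltaSU (Fin N))
    {y : Site (F.P k) 0} {μ : Fin 4} (hb : (⟨y, μ⟩ : PBond (F.P k) 0) ∈ (regionOfSet (F.P k) Z).bonds) :
    ‖mlog (((GaugeField.gaugeAct (fun x => (g (siteShift (ladder F k) x))⁻¹ * u (emb (siteShift (ladder F k) x)))
        (transportRaw F k (blockAvg (expMeanLogSU (n := Fin N))) U) ⟨y, μ⟩ : Matrix.specialUnitaryGroup (Fin N) ℂ) : Matrix (Fin N) (Fin N) ℂ))‖ ≤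
      (F.P (k + 1)).L * ξ * r + 2000 * (((((F.P (k + 1)).d + 2) * (F.P (k + 1)).L : ℕ) : ℝ)) ^ 2 * ξ ^ 2 * r ^ 2 := by
  have hT := gaugeAct_transportRaw_eq F k U (fun y' => (g y')⁻¹ * u (emb y')) y μ
  rw [hT]
  refine norm_mlog_gaugeAct_avgFun_le_local (standing F k) U u hAh hξ hr hg ⟨siteShift (ladder F k) y, μ⟩
    (fun b h1 h2 => hUA b (twoBlocks_subset_bonds_preimage F k Z hb b h1 h2))
    (fun b h1 h2 => hA b (twoBlocks_subset_bonds_preimage F k Z hb b h1 h2)) (fun ρ t ht => ?_) h48 hN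
  have hl := runBond_blockSite_local (standing F k) (⟨siteShift (ladder F k) y, μ⟩ : PBond (F.P (k + 1)) 1) ρ ht
  exact hA _ (twoBlocks_subset_bonds_preimage F k Z hb _ hl.1 hl.2)

/-- ★ **THE COARSE-DIFFERENCE LETTER AT A STENCIL OF `regionOfSet Z`**: at `(y, ν, μ)` with corners in `Z`, given run B's letters on its region over `Z` — `U^u = exp(iξA)`,
`‖A‖ ≤ r` on the bonds, and the unit `ν′`-differences `‖A(x + e_{ν′}, μ′) − A(x, μ′)‖ ≤ r₁` at every stencil `(x, ν′, μ′)` of `regionOfSet (bmap ⁻¹' Z)` (the `grad`-letter of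
(1.12) times `ξ`) — the transported field satisfies `‖log (TU)^{u′_A}(⟨y + e_ν, μ⟩) − log (TU)^{u′_A}(⟨y, μ⟩)‖ ≤ (Lξ)·(L·r₁) + 3200·ℓ²ξ²r·(L·r₁)`, i.e.
`|∇^{ξ′}_ν Ā| ≤ (r₁∕ξ)·(1 + 3200(d+2)²·L·ξ·r)` (the `Le_ν`-differences telescoped INSIDE the region, `translate_step_mem_dpairs_preimage`).
[cite: Balaban1987RG1, (1.12) p.262; Balaban1985Averaging, (62)-(63) p.28, Prop. 3 (123) p.36] -/
theorem norm_shift_sub_mlog_transportRaw_gaugeAct_le (U : GaugeField (F.P (k + 1)) 0 (Matrix.specialUnitaryGroup (Fin N) ℂ))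
    (u : GaugeTransf (F.P (k + 1)) 0 (Matrix.specialUnitaryGroup (Fin N) ℂ)) {A : PBond (F.P (k + 1)) 0 → Matrix (Fin N) (Fin N) ℂ}
    (hAh : ∀ b, star (A b) = A b) {ξ r r₁ : ℝ} (hξ : 0 ≤ ξ) (hr : 0 ≤ r) (hr₁ : 0 ≤ r₁) {g : GaugeTransf (F.P (k + 1)) 1 (Matrix.specialUnitaryGroup (Fin N) ℂ)}
    (hg : ∀ y, ((g y : Matrix.specialUnitaryGroup (Fin N) ℂ) : Matrix (Fin N) (Fin N) ℂ) = exp ((Complex.I * ξ : ℂ) • combMean A y))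
    (Z : Set (Site (F.P k) 0))
    (hUA : ∀ b ∈ (regionOfSet (F.P (k + 1)) ((fun x => (siteShift (ladder F k)).symm (blockOf x)) ⁻¹' Z)).bonds,
      ((GaugeField.gaugeAct u U b : Matrix.specialUnitaryGroup (Fin N) ℂ) : Matrix (Fin N) (Fin N) ℂ) = exp ((Complex.I * ξ : ℂ) • A b))
    (hA : ∀ b ∈ (regionOfSet (F.P (k + 1)) ((fun x => (siteShift (ladder F k)).symm (blockOf x)) ⁻¹' Z)).bonds, ‖A b‖ ≤ r)
    (hA₁ : ∀ (x : Site (F.P (k + 1)) 0) (ν' μ' : Fin 4),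
      (x, ν', μ') ∈ (regionOfSet (F.P (k + 1)) ((fun x => (siteShift (ladder F k)).symm (blockOf x)) ⁻¹' Z)).dpairs → ‖A ⟨x.shift ν', μ'⟩ - A ⟨x, μ'⟩‖ ≤ r₁)
    (h48 : 48 * (((((F.P (k + 1)).d + 2) * (F.P (k + 1)).L : ℕ) : ℝ) * (ξ * r)) ≤ 1)
    (hN : 4 * (((((F.P (k + 1)).d + 2) * (F.P (k + 1)).L : ℕ) : ℝ) * (ξ * r)) < deltaSU (Fin N))
    {y : Site (F.P k) 0} {ν μ : Fin 4} (hq : (y, ν, μ) ∈ (regionOfSet (F.P k) Z).dpairs) :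
    ‖mlog (((GaugeField.gaugeAct (fun x => (g (siteShift (ladder F k) x))⁻¹ * u (emb (siteShift (ladder F k) x)))
          (transportRaw F k (blockAvg (expMeanLogSU (n := Fin N))) U) ⟨y.shift ν, μ⟩ : Matrix.specialUnitaryGroup (Fin N) ℂ) : Matrix (Fin N) (Fin N) ℂ)) -
        mlog (((GaugeField.gaugeAct (fun x => (g (siteShift (ladder F k) x))⁻¹ * u (emb (siteShift (ladder F k) x)))
          (transportRaw F k (blockAvg (expMeanLogSU (n := Fin N))) U) ⟨y, μ⟩ : Matrix.specialUnitaryGroup (Fin N) ℂ) : Matrix (Fin N) (Fin N) ℂ))‖ ≤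
      (F.P (k + 1)).L * ξ * ((F.P (k + 1)).L * r₁) +
        3200 * (((((F.P (k + 1)).d + 2) * (F.P (k + 1)).L : ℕ) : ℝ)) ^ 2 * ξ ^ 2 * r * ((F.P (k + 1)).L * r₁) := by
  have hT1 := gaugeAct_transportRaw_eq F k U (fun y' => (g y')⁻¹ * u (emb y')) (y.shift ν) μ
  have hT0 := gaugeAct_transportRaw_eq F k U (fun y' => (g y')⁻¹ * u (emb y')) y μ
  rw [hT1, hT0, siteShift_shift]
  have hLr₁ : 0 ≤ ((F.P (k + 1)).L : ℝ) * r₁ := mul_nonneg (Nat.cast_nonneg _) hr₁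
  refine norm_shift_sub_mlog_gaugeAct_avgFun_le_local (standing F k) U u hAh (siteShift (ladder F k) y) μ ν hξ hr hLr₁ hg
    (fun b h => hUA b (twoBlocks_pair_subset_bonds_preimage F k Z hq b h))
    (fun b h => hA b (twoBlocks_pair_subset_bonds_preimage F k Z hq b h)) (fun b h1 h2 => ?_) (fun ρ t ht s hs => ?_) h48 hN
  · -- the `Le_ν`-differences on the blocks of `c`, telescoped inside the region
    exact norm_translate_sub_le_of_steps A ν {b' | ((b'.src, ν, b'.dir) : Site (F.P (k + 1)) 0 × Fin 4 × Fin 4) ∈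
        (regionOfSet (F.P (k + 1)) ((fun x => (siteShift (ladder F k)).symm (blockOf x)) ⁻¹' Z)).dpairs}
      (fun b' hb' => hA₁ b'.src ν b'.dir hb') _ b fun m hm => translate_step_mem_dpairs_preimage F k Z hq b h1 h2 hm
  · -- King's (K-b) feeding stencils lie in the region (19c `feedSite_mem_dpairs_preimage`)
    exact hA₁ _ ν μ (YMDAG.N18.TwoRunCubes.feedSite_mem_dpairs_preimage Z hq ρ ht hs)

end Cube

end YMDAG.N18.AvgPotential
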